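import Literature.MathematicalPhysics.QuantumManyBody.PeriodicBoseGasScatteringProfile
import Literature.Analysis.FluidPDE.WholeSpaceIBP
import HarnessLib

/-!
# The scattering equation in `𝒟'(ℝ³)` for bounded potentials

Topic `Literature/MathematicalPhysics/QuantumManyBody`, sibling of `PeriodicBoseGasScatteringProfile.lean`
(provefact `Literature.MathematicalPhysics.QuantumManyBody.BoseGas.Fournais2020_condensation`, layer
`LSSY2005_scatteringSolution` = [LSSY2005, App. C, Thm. C.1] / [Fournais2020, App. A]). For a bounded
measurable potential profile `w ≤ M` vanishing on `(R, ∞)`, `R > 0`, the candidate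
`ω = 1 - f(|x|)` (`scatteringOmega w R`, `PeriodicBoseGasScatteringODE.lean`) is shown to be a
scattering solution in the sense of `IsScatteringSolution` (`PeriodicBoseGasLocalization.lean`):

* `integral_eq_integral_sphereMeasure`: polar coordinates for the Bochner integral on `ℝ³`,
  `∫ F = ∫_{S²} ∫_0^∞ r² F(rω) dr dσ` (from Mathlib's `measurePreserving_homeomorphUnitSphereProd`,
  as the `ℝ≥0∞` version `lintegral_eq_lintegral_sphereMeasure` of `PeriodicBoseGasScattering.lean`);
* `integral_ray_flux_eq`: on every ray, `∫_0^∞ r² f' ∂ᵣψ = -∫_0^∞ ½W r² f ψ` for `ψ ∈ C¹_c`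
  (`profile_flux_identity` with `k = ψ(·ω)`, no boundary terms);
* `integral_scatteringProfile_mul_laplacian`: **`∫ φ₀ Δψ = ½∫ W φ₀ ψ`** for `ψ ∈ C^∞_c(ℝ³)`:
  Green's identity without boundary (`Literature.Analysis.FluidPDE.integral_inner_laplacian_add_eq_zero`,
  `φ₀ ∈ C¹` by `radialFun_contDiff_of_deriv_zero`), `∇φ₀·∇ψ = f'(|x|) ∂ᵣψ`, polar coordinates, the
  ray identity, and polar coordinates back;
* `isScatteringSolution_scatteringOmega`: with `0 < φ₀ ≤ 1`, `φ₀ = 1 - a/|x|` beyond the range,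
  `a = scatteringLength` (`toReal_scatteringLength_eq`) and `∫ wφ₀ = 8πa`
  (`lintegral_pot_mul_scatteringProfile`), all of `PeriodicBoseGasScatteringProfile.lean`.

The extension to unbounded integrable potentials (truncation) is in the sibling file.

## References

* [LSSY2005] E. H. Lieb, R. Seiringer, J. P. Solovej, J. Yngvason, *The Mathematics of the Bose
  Gas and its Condensation*, Birkhäuser 2005, arXiv:cond-mat/0610117: App. C, Thm. C.1 (C.1)–(C.8).
* [Fournais2020] S. Fournais, *Length scales for BEC in the dilute Bose gas*, arXiv:2011.00309:
  App. A (A.1)–(A.5).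
-/

noncomputable section

open MeasureTheory Set Filter Topology Metric
open scoped ENNReal NNReal RealInnerProductSpace Laplacian

namespace Literature.MathematicalPhysics.QuantumManyBody.BoseGas

/-! ### Polar coordinates for the Bochner integral -/

section PolarBochner

/-- **Polar coordinates for the Bochner integral on `ℝ³`**: for an integrable real function,
`∫ F(x) dx = ∫_{S²} ∫_0^∞ r² F(rω) dr dσ(ω)`. [folklore] -/
theorem integral_eq_integral_sphereMeasure {F : Space → ℝ} (hF : Integrable F) :
    ∫ x, F x = ∫ ω, (∫ r in Ioi (0 : ℝ), r ^ 2 * F (r • (ω : Space))) ∂sphereMeasure := by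
  have hmp := (volume : Measure Space).measurePreserving_homeomorphUnitSphereProd
  rw [finrank_euclideanSpace_fin, show (3 : ℕ) - 1 = 2 from rfl] at hmp
  set e := homeomorphUnitSphereProd Space with he
  set g : sphere (0 : Space) 1 × Ioi (0 : ℝ) → ℝ := fun p => F ((e.symm p : _) : Space) with hg
  have hge : g ∘ e = F ∘ Subtype.val := by
    funext x; simp [hg]
  -- integrability on the product
  have hgi : Integrable g (sphereMeasure.prod (Measure.volumeIoiPow 2)) := by
    rw [← hmp.integrable_comp_emb e.measurableEmbedding, hge,
      ← integrableOn_iff_comap_subtypeVal (measurableSet_singleton (0 : Space)).compl]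
    exact hF.integrableOn
  calc ∫ x, F x = ∫ x in ({0}ᶜ : Set Space), F x := by rw [restrict_compl_singleton]
    _ = ∫ x : ({0}ᶜ : Set Space), F x ∂(volume.comap Subtype.val) :=
        (integral_subtype_comap (measurableSet_singleton (0 : Space)).compl F).symm
    _ = ∫ x : ({0}ᶜ : Set Space), g (e x) ∂(volume.comap Subtype.val) := by
        simp only [hg, Homeomorph.symm_apply_apply]
    _ = ∫ p, g p ∂(sphereMeasure.prod (Measure.volumeIoiPow 2)) := hmp.integral_comp e.measurableEmbedding g
    _ = ∫ ω, ∫ r, g (ω, r) ∂(Measure.volumeIoiPow 2) ∂sphereMeasure := integral_prod g hgi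
    _ = _ := by
        refine integral_congr_ae (Eventually.of_forall fun ω => ?_)
        simp only [hg, he, homeomorphUnitSphereProd_symm_apply_coe]
        simp only [Measure.volumeIoiPow, ENNReal.ofReal]
        rw [integral_withDensity_eq_integral_smul (by exact (measurable_subtype_coe.pow_const _).real_toNNReal),
          integral_subtype_comap measurableSet_Ioi fun a ↦ Real.toNNReal (a ^ 2) • F (a • (ω : Space))]
        refine setIntegral_congr_fun measurableSet_Ioi fun r hr => ?_
        rw [NNReal.smul_def, Real.coe_toNNReal _ (pow_nonneg hr.out.le _), smul_eq_mul]

end PolarBochner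

/-! ### The scattering equation -/

section Weak

variable {w : ℝ → ℝ≥0∞} {M R : ℝ}

/-- The coordinate expansion `Dψ(x)x = ∑ᵢ xᵢ ∂ᵢψ(x)`. [folklore] -/
theorem fderiv_apply_self_eq_sum (ψ : Space → ℝ) (x : Space) :
    fderiv ℝ ψ x x = ∑ i : Fin 3, x i * fderiv ℝ ψ x (EuclideanSpace.single i (1 : ℝ)) := by
  have hx : x = ∑ i : Fin 3, x i • EuclideanSpace.single i (1 : ℝ) := by
    conv_lhs => rw [← (EuclideanSpace.basisFun (Fin 3) ℝ).sum_repr x]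
    simp
  have h1 : fderiv ℝ ψ x x = fderiv ℝ ψ x (∑ i : Fin 3, x i • EuclideanSpace.single i (1 : ℝ)) := by
    rw [← hx]
  rw [h1, map_sum]
  simp only [map_smul, smul_eq_mul]

/-- Pointwise: `∑ᵢ ∂ᵢψ(x) ∂ᵢφ₀(x) = f'(|x|)|x|⁻¹ Dψ(x)x` for the radial `φ₀ = f(|x|)`. [folklore] -/
theorem sum_fderiv_mul_fderiv_radialFun {g : ℝ → ℝ} (hg : ContDiff ℝ 1 g) (h0 : deriv g 0 = 0)
    (ψ : Space → ℝ) (x : Space) :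
    ∑ i : Fin 3, fderiv ℝ ψ x (EuclideanSpace.single i (1 : ℝ)) *
        fderiv ℝ (radialFun g) x (EuclideanSpace.single i (1 : ℝ)) =
      deriv g ‖x‖ * (‖x‖)⁻¹ * fderiv ℝ ψ x x := by
  rw [fderiv_apply_self_eq_sum, Finset.mul_sum]
  refine Finset.sum_congr rfl fun i _ => ?_
  rw [fderiv_radialFun' hg h0 x, FunLike.coe_smul, Pi.smul_apply, innerSL_apply_apply,
    EuclideanSpace.inner_single_right]
  simp only [one_mul, smul_eq_mul, conj_trivial]
  ring

variable (hw : Measurable w) (hM : ∀ r, w r ≤ ENNReal.ofReal M) (hM0 : 0 ≤ M)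
include hw hM hM0

/-- **The ray form of the scattering equation**: for `ψ ∈ C¹_c(ℝ³)` and every direction `ω`,
`∫_0^∞ r² f'(r) ∂ᵣψ(rω) dr = -∫_0^∞ ½W(r) r² f(r) ψ(rω) dr`. [cite: LSSY2005, App. C (C.2); Fournais2020, (A.1)] -/
theorem integral_ray_flux_eq (R : ℝ) {ψ : Space → ℝ} (hψ : ContDiff ℝ 1 ψ) (hψc : HasCompactSupport ψ)
    (ω : sphere (0 : Space) 1) :
    ∫ r in Ioi (0 : ℝ), r ^ 2 * deriv (radialProfile w R) r * deriv (rayFun ψ ω) r =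
      -∫ r in Ioi (0 : ℝ), (w r).toReal / 2 * r ^ 2 * radialProfile w R r * rayFun ψ ω r := by
  -- a radius beyond the support
  obtain ⟨Rψ, hRψ⟩ := hψc.isCompact.isBounded.subset_closedBall 0
  set T : ℝ := max Rψ 0 + 1 with hT
  have hT0 : 0 < T := by have := le_max_right Rψ 0; linarith
  have hout : ∀ r, T ≤ r → (r • (ω : Space)) ∉ tsupport ψ := by
    intro r hr hmem
    have h1 := hRψ hmem
    rw [mem_closedBall, dist_zero_right, norm_smul, norm_eq_of_mem_sphere ω, mul_one,
      Real.norm_of_nonneg (hT0.le.trans hr)] at h1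
    have := le_max_left Rψ 0
    linarith
  have hk0 : ∀ r, T ≤ r → rayFun ψ ω r = 0 := fun r hr => by
    show ψ (r • (ω : Space)) = 0
    exact image_eq_zero_of_notMem_tsupport (hout r hr)
  have hk'0 : ∀ r, T ≤ r → deriv (rayFun ψ ω) r = 0 := by
    intro r hr
    rw [deriv_rayFun (hψ.differentiable one_ne_zero), fderiv_of_notMem_tsupport ℝ (hout r hr)]
    rfl
  have hflux := profile_flux_identity hw hM hM0 R hT0 (contDiff_rayFun hψ ω)
  rw [hk0 T le_rfl, mul_zero, zero_sub] at hflux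
  rw [setIntegral_eq_of_subset_of_forall_sdiff_eq_zero measurableSet_Ioi Ioc_subset_Ioi_self,
    setIntegral_eq_of_subset_of_forall_sdiff_eq_zero (s := Ioc 0 T) measurableSet_Ioi Ioc_subset_Ioi_self, hflux]
  · intro r hr
    have hrT : T ≤ r := by
      by_contra h
      exact hr.2 ⟨hr.1, (not_le.mp h).le⟩
    rw [hk0 r hrT, mul_zero]
  · intro r hr
    have hrT : T ≤ r := by
      by_contra h
      exact hr.2 ⟨hr.1, (not_le.mp h).le⟩
    rw [hk'0 r hrT, mul_zero]

omit hw hM hM0 in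
/-- A bounded measurable function vanishing off a compact set is integrable. [folklore] -/
theorem integrable_of_bounded_of_tsupport_subset {F : Space → ℝ} {K : Set Space} (hK : IsCompact K)
    (hFm : AEStronglyMeasurable F volume) {C : ℝ} (hC : ∀ x, ‖F x‖ ≤ C) (hsupp : Function.support F ⊆ K) :
    Integrable F := by
  rw [← integrableOn_iff_integrable_of_support_subset hsupp]
  exact Measure.integrableOn_of_bounded hK.measure_lt_top.ne hFm (Eventually.of_forall hC)

omit hw hM hM0 in
/-- `|x|`-powers times the potential: on a ray, `r²·(W(r)/2)·h` for continuous `h` vanishing beyond `T`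
integrates over `(0, ∞)` as over `(0, T]`. [folklore] -/
theorem setIntegral_Ioi_eq_Ioc_of_eq_zero {F : ℝ → ℝ} {T : ℝ} (hF : ∀ r, T < r → F r = 0) :
    ∫ r in Ioi (0 : ℝ), F r = ∫ r in Ioc 0 T, F r := by
  refine setIntegral_eq_of_subset_of_forall_sdiff_eq_zero measurableSet_Ioi Ioc_subset_Ioi_self fun r hr => hF r ?_
  by_contra h
  exact hr.2 ⟨hr.1, not_lt.mp h⟩

/-- **The scattering equation in `𝒟'(ℝ³)`** for the profile of a bounded potential:
`∫ φ₀ Δψ = ½ ∫ W φ₀ ψ` for every `ψ ∈ C^∞_c(ℝ³)`, `φ₀ = f(|x|)` — Green's identity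
`∫ φ₀Δψ = -∫ ∇φ₀·∇ψ`, polar coordinates, and the ray identity `integral_ray_flux_eq`.
[cite: Fournais2020, App. A (A.1); LSSY2005, App. C (C.1)–(C.2)] -/
theorem integral_scatteringProfile_mul_laplacian (R : ℝ) {ψ : Space → ℝ} (hψ : ContDiff ℝ (⊤ : ℕ∞) ψ)
    (hψc : HasCompactSupport ψ) :
    ∫ x, scatteringProfile w R x * (Δ ψ) x =
      2⁻¹ * ∫ x, (w ‖x‖).toReal * scatteringProfile w R x * ψ x := by
  set f := radialProfile w R with hf_def
  have hf : ContDiff ℝ 1 f := contDiff_radialProfile hw hM hM0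
  have hf0 : deriv f 0 = 0 := deriv_radialProfile_zero hw hM hM0
  have hφ : ContDiff ℝ 1 (radialFun f) := radialFun_contDiff_of_deriv_zero hf hf0
  have hφeq : scatteringProfile w R = radialFun f := rfl
  have hψ1 : ContDiff ℝ 1 ψ := hψ.of_le (by norm_cast)
  have hψ2 : ContDiff ℝ 2 ψ := hψ.of_le (by norm_cast)
  set b := EuclideanSpace.basisFun (Fin 3) ℝ with hb
  have hbi : ∀ i, b i = EuclideanSpace.single i (1 : ℝ) := fun i => by rw [hb, EuclideanSpace.basisFun_apply]
  -- Step 1: Green's identity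
  have hG := Literature.Analysis.FluidPDE.integral_inner_laplacian_add_eq_zero b hψ2 hφ (Or.inl hψc)
  have hinner : ∀ a c : ℝ, ⟪a, c⟫ = a * c := fun a c => by simp [mul_comm]
  simp only [hinner, hbi] at hG
  -- Step 2: the gradient pairing as one integral
  set H : Space → ℝ := fun x => ∑ i : Fin 3, fderiv ℝ ψ x (EuclideanSpace.single i (1 : ℝ)) *
    fderiv ℝ (radialFun f) x (EuclideanSpace.single i (1 : ℝ)) with hH
  have hHi : ∀ i : Fin 3, Integrable (fun x => fderiv ℝ ψ x (EuclideanSpace.single i (1 : ℝ)) *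
      fderiv ℝ (radialFun f) x (EuclideanSpace.single i (1 : ℝ))) := by
    intro i
    refine Continuous.integrable_of_hasCompactSupport ?_ ?_
    · exact ((hψ1.continuous_fderiv one_ne_zero).clm_apply continuous_const).mul
        ((hφ.continuous_fderiv one_ne_zero).clm_apply continuous_const)
    · exact (hψc.fderiv_apply (𝕜 := ℝ) (EuclideanSpace.single i (1 : ℝ))).mul_right
  have hsum : ∑ i : Fin 3, ∫ x, fderiv ℝ ψ x (EuclideanSpace.single i (1 : ℝ)) *
      fderiv ℝ (radialFun f) x (EuclideanSpace.single i (1 : ℝ)) = ∫ x, H x := by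
    rw [hH, integral_finsetSum _ fun i _ => hHi i]
  have hHint : Integrable H := by
    rw [hH]; exact integrable_finsetSum _ fun i _ => hHi i
  -- Step 3: polar coordinates for `H`
  have hHpol := integral_eq_integral_sphereMeasure hHint
  have hHray : ∀ ω : sphere (0 : Space) 1, ∀ r ∈ Ioi (0 : ℝ),
      r ^ 2 * H (r • (ω : Space)) = r ^ 2 * deriv f r * deriv (rayFun ψ ω) r := by
    intro ω r hr
    have hr0 : 0 < r := hr
    rw [hH]
    simp only
    rw [sum_fderiv_mul_fderiv_radialFun hf hf0, norm_smul, norm_eq_of_mem_sphere ω, mul_one,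
      Real.norm_of_nonneg hr0.le, map_smul, smul_eq_mul, deriv_rayFun (hψ1.differentiable one_ne_zero)]
    field_simp
  have hHpol' : ∫ x, H x = ∫ ω, (∫ r in Ioi (0 : ℝ), r ^ 2 * deriv f r * deriv (rayFun ψ ω) r) ∂sphereMeasure := by
    rw [hHpol]
    refine integral_congr_ae (Eventually.of_forall fun ω => ?_)
    exact setIntegral_congr_fun measurableSet_Ioi (hHray ω)
  -- Step 4: the ray identity
  have hray : ∀ ω : sphere (0 : Space) 1,
      ∫ r in Ioi (0 : ℝ), r ^ 2 * deriv f r * deriv (rayFun ψ ω) r =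
        -∫ r in Ioi (0 : ℝ), (w r).toReal / 2 * r ^ 2 * f r * rayFun ψ ω r :=
    fun ω => integral_ray_flux_eq hw hM hM0 R hψ1 hψc ω
  simp_rw [hray] at hHpol'
  rw [integral_neg] at hHpol'
  -- Step 5: polar coordinates for `G = ½ W φ₀ ψ`
  set G : Space → ℝ := fun x => (w ‖x‖).toReal / 2 * (radialFun f x * ψ x) with hG_def
  obtain ⟨C, hC⟩ := (hψc.mul_left (f := radialFun f)).exists_bound_of_continuous (hφ.continuous.mul hψ.continuous)
  have hGint : Integrable G := by
    refine integrable_of_bounded_of_tsupport_subset hψc ?_ (C := M / 2 * C) (fun x => ?_) fun x hx => ?_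
    · exact (((hw.comp measurable_norm).ennreal_toReal.div_const 2).mul
        (hφ.continuous.mul hψ.continuous).measurable).aestronglyMeasurable
    · rw [hG_def, norm_mul, Real.norm_eq_abs, abs_of_nonneg (div_nonneg ENNReal.toReal_nonneg zero_le_two)]
      have h1 : (w ‖x‖).toReal / 2 ≤ M / 2 := by linarith [toReal_pot_le hM hM0 ‖x‖]
      have h2 := hC x
      have : 0 ≤ (w ‖x‖).toReal / 2 := div_nonneg ENNReal.toReal_nonneg zero_le_two
      exact mul_le_mul h1 h2 (norm_nonneg _) (by linarith)
    · refine subset_tsupport _ ?_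
      rw [Function.mem_support] at hx ⊢
      intro h0
      exact hx (by rw [hG_def]; simp [h0])
  have hGpol := integral_eq_integral_sphereMeasure hGint
  have hGray : ∀ ω : sphere (0 : Space) 1, ∀ r ∈ Ioi (0 : ℝ),
      r ^ 2 * G (r • (ω : Space)) = (w r).toReal / 2 * r ^ 2 * f r * rayFun ψ ω r := by
    intro ω r hr
    have hr0 : 0 < r := hr
    rw [hG_def]
    simp only [radialFun, rayFun]
    rw [norm_smul, norm_eq_of_mem_sphere ω, mul_one, Real.norm_of_nonneg hr0.le]
    ring
  have hGpol' : ∫ x, G x = ∫ ω, (∫ r in Ioi (0 : ℝ), (w r).toReal / 2 * r ^ 2 * f r * rayFun ψ ω r) ∂sphereMeasure := by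
    rw [hGpol]
    refine integral_congr_ae (Eventually.of_forall fun ω => ?_)
    exact setIntegral_congr_fun measurableSet_Ioi (hGray ω)
  -- Step 6: assemble
  have hL : ∫ x, scatteringProfile w R x * (Δ ψ) x = -∫ x, H x := by
    have : ∫ x, scatteringProfile w R x * (Δ ψ) x = ∫ x, (Δ ψ) x * radialFun f x := by
      rw [hφeq]; exact integral_congr_ae (Eventually.of_forall fun x => mul_comm _ _)
    rw [this]
    linarith [hG, hsum]
  have hRHS : 2⁻¹ * ∫ x, (w ‖x‖).toReal * scatteringProfile w R x * ψ x = ∫ x, G x := by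
    rw [hG_def, ← integral_const_mul]
    refine integral_congr_ae (Eventually.of_forall fun x => ?_)
    rw [hφeq]
    simp only
    ring
  rw [hL, hHpol', neg_neg, hRHS, hGpol']

end Weak

/-! ### The scattering solution of a bounded potential -/

section Bounded

variable {w : ℝ → ℝ≥0∞} {M R : ℝ}

/-- **The scattering solution of a bounded finite-range potential.** For measurable `w ≤ M` vanishing
on `(R, ∞)`, `R > 0`, the function `ω = 1 - u(|x|)/(u'(R)|x|)` built from the regular zero-energy
radial solution is a scattering solution: `0 ≤ ω ≤ 1`, radial, `ω = a/|x|` beyond the range with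
`a` the variational scattering length, `(-Δ + ½w)(1 - ω) = 0` in `𝒟'(ℝ³)`, and `∫ w(1 - ω) = 8πa`.
[cite: LSSY2005, App. C, Thm. C.1; Fournais2020, App. A (A.1)–(A.5)] -/
theorem isScatteringSolution_scatteringOmega (hw : Measurable w) (hM : ∀ r, w r ≤ ENNReal.ofReal M)
    (hM0 : 0 ≤ M) (hR : 0 < R) (hwR : ∀ s, R < s → w s = 0) :
    IsScatteringSolution w (scatteringOmega w R) where
  measurable := (continuous_const.sub (continuous_scatteringProfile hw hM hM0 hR hwR)).measurable
  nonneg x := by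
    rw [scatteringOmega, sub_nonneg]
    exact (scatteringProfile_mem hw hM hM0 hR hwR x).2
  le_one x := by
    rw [scatteringOmega, sub_le_self_iff]
    exact (scatteringProfile_mem hw hM hM0 hR hwR x).1.le
  radial x y h := by
    rw [scatteringOmega, scatteringOmega, scatteringProfile_radial w R h]
  eq_div R₀ hR₀ x hx := by
    rw [scatteringOmega, scatteringProfile_eq_one_sub_div hw hM hM0 hR hwR hR₀ hx,
      toReal_scatteringLength_eq hw hM hM0 hR hwR]
    ring
  weak_eq ψ hψ hψc := by
    simp_rw [one_sub_scatteringOmega]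
    exact integral_scatteringProfile_mul_laplacian hw hM hM0 R hψ hψc
  lintegral_g := by
    simp_rw [one_sub_scatteringOmega]
    exact lintegral_pot_mul_scatteringProfile hw hM hM0 hR hwR

end Bounded

end Literature.MathematicalPhysics.QuantumManyBody.BoseGas

end
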